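import Literature.Analysis.FunctionSpaces.BesselITuranSharp
import Literature.Analysis.FunctionSpaces.BesselIRecurrence
import HarnessLib

/-!
# Venture YMGap, track Y3 FLOW-DATA — the circle transfer operator's eigenvalues are STRICTLY LOG-CONCAVE along the
# character index, with the sharp Turán ratio: every second difference of the `d = 2` flux-sector energies lies in
# `(0, L·ln((n+3)/(n+2)))` (theorems only)

HONEST FRAMING: venture file of the cell `pub-ymgap` (QuantumFields programme), track Y3 (FLOW-DATA); companion THEOREMS
for `FlowData/CircleSpectralResolution.lean`, whose `hasSum_tubeTransferOperator_sliceOne` resolves the `SU(2)` tube transfer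
operator on the circle `(ℤ/L)¹` (theory dimension two) as `T ψ = Σ_n λ_n ⟪φ_n, ψ⟫ φ_n` with the EIGENVALUE LIST
`λ_n(β, L) = ((I_n(β) − I_{n+2}(β))/(n+1))^L` (`φ_n = χ_n ∘ hol`; the flux-`j` sector is `n = 2j`).  This file is about
that explicit list only (real analysis of Bessel functions; no operator theory is re-done): finite `L ≥ 1`, `β > 0`;
nothing about `L → ∞`, the continuum or a mass gap in the thermodynamic sense.

* `circleEigenvalue_eq_pow` — `λ_n = (2 I_{n+1}(β)/β)^L` (DLMF 10.29.1), `circleEigenvalue_pos`;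
* **`circleEigenvalue_mul_div_sq_eq`** — `λ_n λ_{n+2} / λ_{n+1}² = (I_{n+1} I_{n+3} / I_{n+2}²)^L`;
* **`circleEigenvalue_mul_div_sq_mem_Ioo`** — `((n+2)/(n+3))^L < λ_n λ_{n+2} / λ_{n+1}² < 1` (the two-sided sharp Turán
  inequality `besselI_mul_besselI_div_sq_mem_Ioo`, Baricz 2010 Thm 2.1 at integer order): the eigenvalue list is strictly
  log-concave in `n`;
* **`circleSectorEnergy_secondDiff_mem_Ioo`** — equivalently, for the sector energies `E(n) = −ln λ_n` the second
  difference `D_{n+1} = E(n+2) − 2E(n+1) + E(n) = ln(λ_{n+1}²/(λ_n λ_{n+2}))` lies in `(0, L·ln((n+3)/(n+2)))`;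
  the FLOW-TABLE's T-2D TURÁN cells: **`circleSectorEnergy_secondDiff_one_mem_Ioo`** (`n = 0`: `D₁ = m′ − 2E₁ ∈ (0, L ln 3/2)`,
  column T1) and **`circleSectorEnergy_secondDiff_two_mem_Ioo`** (`n = 1`: `D₂ = E_{3/2} − 2m′ + E₁ ∈ (0, L ln 4/3)`, column
  T2 — its typed twin).

References: Á. Baricz, Proc. AMS 138 (2010) 575, Thm 2.1 [cite: Baricz2010TuranBessel, Theorem 2.1]; DLMF §10.29.1
[cite: DLMF, 10.29.1]; I. Montvay, G. Münster (1994) §3.2.6 [cite: MontvayMunster1994, §3.2.6].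
-/

noncomputable section

open Literature.Analysis.FunctionSpaces

namespace Summit.Ventures.YMGap.FlowData

section CircleTuran

variable {β : ℝ}

/-- Positivity of the integral-defined `I_n(β)` for `β > 0` (bridge to the series copy). [folklore] -/
private theorem besselI_pos_aux (hβ : 0 < β) (n : ℕ) : 0 < besselI n β := by
  rw [besselI_eq_latticeModels_besselI]
  exact Literature.Probability.LatticeModels.besselI_pos hβ _

/-- **`λ_n = (2 I_{n+1}(β)/β)^L`**: the circle eigenvalue list of `hasSum_tubeTransferOperator_sliceOne` in closed form
(three-term recurrence `I_n − I_{n+2} = (2(n+1)/β) I_{n+1}`). [cite: DLMF, 10.29.1] -/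
theorem circleEigenvalue_eq_pow (hβ : β ≠ 0) (n L : ℕ) :
    ((besselI n β - besselI (n + 2) β) / (n + 1)) ^ L = (2 / β * besselI (n + 1) β) ^ L := by
  rw [besselI_sub_besselI_add_two n hβ]
  congr 1
  have hn : ((n : ℝ) + 1) ≠ 0 := by positivity
  field_simp

/-- The circle eigenvalues are positive for `β > 0`. [folklore] -/
theorem circleEigenvalue_pos (hβ : 0 < β) (n L : ℕ) : 0 < ((besselI n β - besselI (n + 2) β) / (n + 1)) ^ L := by
  rw [circleEigenvalue_eq_pow hβ.ne' n L]
  exact pow_pos (mul_pos (div_pos two_pos hβ) (besselI_pos_aux hβ _)) L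

/-- **`λ_n λ_{n+2} / λ_{n+1}² = (I_{n+1} I_{n+3} / I_{n+2}²)^L`**: the log-concavity quotient of the eigenvalue list is the
`L`-th power of the Turán quotient. [folklore] -/
theorem circleEigenvalue_mul_div_sq_eq (hβ : 0 < β) (n L : ℕ) :
    ((besselI n β - besselI (n + 2) β) / (n + 1)) ^ L * ((besselI (n + 2) β - besselI (n + 2 + 2) β) / ((n + 2 : ℕ) + 1)) ^ L /
        (((besselI (n + 1) β - besselI (n + 1 + 2) β) / ((n + 1 : ℕ) + 1)) ^ L) ^ 2 =
      (besselI (n + 1) β * besselI (n + 3) β / besselI (n + 2) β ^ 2) ^ L := by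
  rw [circleEigenvalue_eq_pow hβ.ne', circleEigenvalue_eq_pow hβ.ne', circleEigenvalue_eq_pow hβ.ne']
  have h2 : (2 : ℝ) / β ≠ 0 := div_ne_zero two_ne_zero hβ.ne'
  have hI : besselI (n + 2) β ≠ 0 := (besselI_pos_aux hβ _).ne'
  simp only [show n + 2 + 1 = n + 3 from rfl, show n + 1 + 1 = n + 2 from rfl]
  rw [← mul_pow, ← pow_mul, mul_comm L 2, pow_mul, ← div_pow]
  congr 1
  field_simp

/-- **THE EIGENVALUE LIST IS STRICTLY LOG-CONCAVE WITH THE SHARP TURÁN RATIO**: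
`((n+2)/(n+3))^L < λ_n λ_{n+2} / λ_{n+1}² < 1` for `β > 0`, `L ≥ 1`. [cite: Baricz2010TuranBessel, Theorem 2.1] -/
theorem circleEigenvalue_mul_div_sq_mem_Ioo (hβ : 0 < β) (n : ℕ) {L : ℕ} (hL : 1 ≤ L) :
    ((besselI n β - besselI (n + 2) β) / (n + 1)) ^ L * ((besselI (n + 2) β - besselI (n + 2 + 2) β) / ((n + 2 : ℕ) + 1)) ^ L /
        (((besselI (n + 1) β - besselI (n + 1 + 2) β) / ((n + 1 : ℕ) + 1)) ^ L) ^ 2 ∈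
      Set.Ioo ((((n : ℝ) + 2) / ((n : ℝ) + 3)) ^ L) 1 := by
  rw [circleEigenvalue_mul_div_sq_eq hβ]
  have hq := besselI_mul_besselI_div_sq_mem_Ioo (n + 1) hβ
  have hlo : ((n : ℝ) + 2) / ((n : ℝ) + 3) < besselI (n + 1) β * besselI (n + 3) β / besselI (n + 2) β ^ 2 := by
    have h := hq.1
    have e1 : (((n + 1 : ℕ) : ℝ) + 1) / (((n + 1 : ℕ) : ℝ) + 2) = ((n : ℝ) + 2) / ((n : ℝ) + 3) := by
      push_cast; ring_nf
    rw [e1] at h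
    exact h
  have hhi : besselI (n + 1) β * besselI (n + 3) β / besselI (n + 2) β ^ 2 < 1 := hq.2
  have hL0 : L ≠ 0 := by omega
  have hpos : 0 ≤ ((n : ℝ) + 2) / ((n : ℝ) + 3) := by positivity
  constructor
  · exact pow_lt_pow_left₀ hlo hpos hL0
  · calc (besselI (n + 1) β * besselI (n + 3) β / besselI (n + 2) β ^ 2) ^ L < 1 ^ L :=
          pow_lt_pow_left₀ hhi (hpos.trans hlo.le) hL0
      _ = 1 := one_pow L

/-- **SECOND DIFFERENCES OF THE `d = 2` SECTOR ENERGIES**: with `E(n) = −ln λ_n`,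
`0 < E(n+2) − 2E(n+1) + E(n) = ln(λ_{n+1}² / (λ_n λ_{n+2})) < L · ln((n+3)/(n+2))` (`β > 0`, `L ≥ 1`): the flux-sector
energies on the circle are strictly convex in the flux, with the sharp Turán ceiling. [cite: Baricz2010TuranBessel, Theorem 2.1] -/
theorem circleSectorEnergy_secondDiff_mem_Ioo (hβ : 0 < β) (n : ℕ) {L : ℕ} (hL : 1 ≤ L) :
    Real.log ((((besselI (n + 1) β - besselI (n + 1 + 2) β) / ((n + 1 : ℕ) + 1)) ^ L) ^ 2 /
        (((besselI n β - besselI (n + 2) β) / (n + 1)) ^ L *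
          ((besselI (n + 2) β - besselI (n + 2 + 2) β) / ((n + 2 : ℕ) + 1)) ^ L)) ∈
      Set.Ioo 0 ((L : ℝ) * Real.log (((n : ℝ) + 3) / ((n : ℝ) + 2))) := by
  have hmem := circleEigenvalue_mul_div_sq_mem_Ioo hβ n hL
  set q : ℝ := ((besselI n β - besselI (n + 2) β) / (n + 1)) ^ L *
      ((besselI (n + 2) β - besselI (n + 2 + 2) β) / ((n + 2 : ℕ) + 1)) ^ L /
        (((besselI (n + 1) β - besselI (n + 1 + 2) β) / ((n + 1 : ℕ) + 1)) ^ L) ^ 2 with hq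
  have hnum : 0 < ((besselI n β - besselI (n + 2) β) / (n + 1)) ^ L *
      ((besselI (n + 2) β - besselI (n + 2 + 2) β) / ((n + 2 : ℕ) + 1)) ^ L := by
    have h1 := circleEigenvalue_pos hβ n L
    have h2 := circleEigenvalue_pos hβ (n + 2) L
    push_cast at h2 ⊢
    exact mul_pos h1 h2
  have hden : 0 < (((besselI (n + 1) β - besselI (n + 1 + 2) β) / ((n + 1 : ℕ) + 1)) ^ L) ^ 2 := by
    have h1 := circleEigenvalue_pos hβ (n + 1) L
    push_cast at h1 ⊢
    positivity
  have hq0 : 0 < q := hmem.1.trans_le' (by positivity) |>.trans_le le_rfl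
  have hinv : (((besselI (n + 1) β - besselI (n + 1 + 2) β) / ((n + 1 : ℕ) + 1)) ^ L) ^ 2 /
      (((besselI n β - besselI (n + 2) β) / (n + 1)) ^ L *
        ((besselI (n + 2) β - besselI (n + 2 + 2) β) / ((n + 2 : ℕ) + 1)) ^ L) = q⁻¹ := by
    rw [hq, inv_div]
  rw [hinv, Real.log_inv]
  have hr : 0 < ((n : ℝ) + 2) / ((n : ℝ) + 3) := by positivity
  constructor
  · -- `q < 1 ⇒ 0 < −ln q`
    have := Real.log_neg hq0 hmem.2
    linarith
  · -- `((n+2)/(n+3))^L < q ⇒ −ln q < L ln((n+3)/(n+2))`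
    have h1 : Real.log ((((n : ℝ) + 2) / ((n : ℝ) + 3)) ^ L) < Real.log q := Real.log_lt_log (pow_pos hr L) hmem.1
    rw [Real.log_pow] at h1
    have h2 : Real.log (((n : ℝ) + 3) / ((n : ℝ) + 2)) = -Real.log (((n : ℝ) + 2) / ((n : ℝ) + 3)) := by
      rw [← Real.log_inv, inv_div]
    rw [h2]
    linarith

/-- **The FLOW-TABLE's T1 cell** (`n = 0`): `0 < ln(λ₁²/(λ₀λ₂)) < L·ln(3/2)` — in the table's words `D₁ = m′ − 2E₁ ∈
(0, L ln 3/2)` (`E₁ = −ln(λ₁/λ₀)` the torelon, `m′ = −ln(λ₂/λ₀)` the glueball energy of the circle).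
[cite: Baricz2010TuranBessel, Theorem 2.1] -/
theorem circleSectorEnergy_secondDiff_one_mem_Ioo (hβ : 0 < β) {L : ℕ} (hL : 1 ≤ L) :
    Real.log ((((besselI 1 β - besselI 3 β) / 2) ^ L) ^ 2 /
        ((besselI 0 β - besselI 2 β) ^ L * ((besselI 2 β - besselI 4 β) / 3) ^ L)) ∈
      Set.Ioo 0 ((L : ℝ) * Real.log (3 / 2)) := by
  have h := circleSectorEnergy_secondDiff_mem_Ioo hβ 0 hL
  norm_num at h ⊢
  exact h

/-- **The FLOW-TABLE's T2 cell** (`n = 1`): `0 < ln(λ₂²/(λ₁λ₃)) < L·ln(4/3)` — in the table's words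
`D₂ = E_{3/2} − 2m′ + E₁ ∈ (0, L ln 4/3)` (its typed twin). [cite: Baricz2010TuranBessel, Theorem 2.1] -/
theorem circleSectorEnergy_secondDiff_two_mem_Ioo (hβ : 0 < β) {L : ℕ} (hL : 1 ≤ L) :
    Real.log ((((besselI 2 β - besselI 4 β) / 3) ^ L) ^ 2 /
        (((besselI 1 β - besselI 3 β) / 2) ^ L * ((besselI 3 β - besselI 5 β) / 4) ^ L)) ∈
      Set.Ioo 0 ((L : ℝ) * Real.log (4 / 3)) := by
  have h := circleSectorEnergy_secondDiff_mem_Ioo hβ 1 hL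
  norm_num at h ⊢
  exact h

end CircleTuran

end Summit.Ventures.YMGap.FlowData
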